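/-
Copyright (c) 2026 the pub-hodgecm-mathlib formalisation cell (harness21).  Prover seat hodgecm-mathlib-LH7-p09 (g0), re-dealt by director s1969 (a) to strike line L3
`stub_N6nsDyadic` (Track A «(D-RAM) FOUR-FRAME» squad F0∕P3c∕LH4; heir LEAD F0P3a-plan (g21) T20-16 (R-35), sub-dealers LH4-p05 (g8) (β-table) ∕ LH4-p04 (g8) (β₂-face));
helper lane on h413 = stmt-HodgeConjecture-24833 (count-neutral).  Row (P5) «H `(2ρ,2ρ,2ρ)`» of LH4-p05 (g8)'s β-TABLE ROW LEDGER 14:46:05Z — THE `q = 2` HALF.  2026-09-04.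
-/
import Summits.HodgeConjecture.HodgeConjecture.Theorems.F0P3cDyRamDiagonalCoreHangingSocket   -- ★ (LH4-p07 (g3)): `stratum_H_eq` (the stratum `(2ρ,2ρ,2ρ)` is the core-hanging frame set); brings ★ StrataDefs `stratum`, the datum defs
import Summits.HodgeConjecture.HodgeConjecture.Theorems.F0P3cDyRamLabelledOddCountDefs        -- ★ DEFS (LH4-p05 (g8)): `labelledOddCount`, `valueClassLabel` (the (β) odd-table currency of ★ p860646 `…LabelledOddStageBBoxForm`)
import Summits.HodgeConjecture.HodgeConjecture.Theorems.F0P3cDyRamStageOneBDefs               -- ★ DEFS №5: `mcOfRecord`; brings `mstarOfRecord`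
import Summits.HodgeConjecture.HodgeConjecture.Theorems.F0P3cDyRamDiagonalKappaCountDefs        -- ★ DEFS: `kappaCount` (the (L-lev)∕(sq) roads' `κ·w` currency)
import Literature.NumberTheory.Automorphic.UnitaryLatticeTreeResiduallyUnipotentCorner        -- ★ `residue_eq_zero_iff_v_lt_one` (the `Valued` residue plumbing)
import Literature.Algebra.GroupRings.TrivialUnits                                             -- ★ `eq_zero_or_eq_one_of_card_eq_two`, `two_eq_zero_of_card_eq_two` (a two-element ring is `{0,1}`, `2 = 0`)
import HarnessLib

/-!
# Crux `H413`, line LH4 «(D-RAM) FOUR-FRAME» — row (P5) «H» of the Stage-B tables, THE `q = 2` HALF: over a valued field whose residue field has TWO elements the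
# core-hanging stratum `stratum σ ϖ T (2ρ, 2ρ, 2ρ)` (`ρ ≥ 1`) is EMPTY, so every per-stratum table on it — in particular the (β) labelled-odd row `hH` of (T1) — is `0`

Cell `hodgecm-mathlib` (D-0151), FLOOR 0, crux item H413 = `stmt-HodgeConjecture-24833`, route `HCCMUnconditional`; squad F0∕P3c∕LH4.  THEOREMS ONLY (no `def`, no instance, no
notation, no `sorry`, default heartbeats); ★-only imports; lane `--supports stmt-HodgeConjecture-24833 --as helper` (count-neutral); pays NO tier-0 row, states NO law.

THE MATHEMATICS.  ★ `stratum_H_eq` (F0P3cDyRamDiagonalCoreHangingSocket §1): for `ρ ≥ 1` and any `T`, a member of `stratum σ ϖ T (2ρ, 2ρ, 2ρ)` is a glued normal form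
`latt (1 0 0; x ϖ^ρ 0; xζ + y″ ϖ^ρζ ϖ^{2ρ})` with FOUR unit letters `|x| = |ζ| = |y″| = |xζ + y″| = 1`.  If the residue field `𝓀 = 𝒪∕𝓂` has exactly two elements, every unit of `𝒪`
reduces to `1 ∈ 𝓀` and `1 + 1 = 0` in `𝓀` (§1, over ★ `Literature.Algebra.GroupRings.eq_zero_or_eq_one_of_card_eq_two` ∕ `two_eq_zero_of_card_eq_two`: a two-element ring is `{0, 1}` with `2 = 0`), so `xζ + y″ ≡ 1·1 + 1 = 0 (mod 𝓂)` — the fourth letter fails: the stratum is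
EMPTY (§2), with no hypothesis on `T`, the element datum or the windows (compare ★ `stratum_H_eq_empty_of_no_window`, which needs both windows closed; here the tube window
`2ρ ≤ min nᵢ` may be open — its weighted count `(q − 2)q^{2ρ−1}` of ★ `finsum_stabiliserWeight_hasAxis_H` vanishes at `q = 2` for this reason).  The same digit shows that at `q = 2`
NO element datum is EQUILATERAL (§2: `n₁ = n₂ ⇒ n₃ > n₁`, since `(α−1)∕ϖⁿ − (β−1)∕ϖⁿ` is a difference of two units), so the equilateral glue window of the H sockets is void as well.
§3 CONSEQUENCES FOR THE TABLES: for ANY shell predicate `Q` and ANY weight `f` into an additive commutative monoid, `Σᶠ_{M ∈ stratum(2ρ,2ρ,2ρ) ∧ Q M} f M = 0`; spelled out in the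
currency of ★ p860646 `F0P3cDyRamLabelledOddStageBBoxForm.table_of_box` (clean shell `(d%2, ¬(d%2+1), mcOfRecord d)`, label `valueClassLabel σ ϖ (α−1) (β−1) (mstarOfRecord d) d`,
weight `labelledOddCount…∕[𝒰 : N S̃′]`) this is the (T1) v0 binder `hH : v ![2ρ, 2ρ, 2ρ] = 0` of F0P3a-p01 (g37)'s `OddLabelledBoxSum` DISCHARGED AT `q = 2` with no label read;
and in the `κ·w` currency of the (L-lev)∕(sq) roads (★ `cell_H`) likewise.  The `q ≥ 4` half of row (P5) (populated tube `2ρ = m − ℓ₀`, ODDBOX-ORACLE v1 §3 special slot) is NOT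
claimed here.
HONEST LABEL.  Count-neutral helper; (β)∕SIG-B2b3∕(β-BAL)∕β₂∕T₊ remain OPEN; `HC_CM` is proved only modulo the 7 printed citations (2 remaining named inputs: hLiu418 =
`stmt-HodgeConjecture-24832`, h413 = `stmt-HodgeConjecture-24833`) until rung 0 closes.  Nothing printed is asserted.

## References
* [Kottwitz1986BaseChangeUnits] R. E. Kottwitz, *Base change for unit elements of Hecke algebras*, Compositio Math. 60 (1986), §1 pp. 240–241 (lattice counts by strata ∕ torus orbits).
* [Serre1980Trees] J.-P. Serre, *Trees*, Springer (1980), Ch. II §1.1 (lattices `g·𝒪^N`, Hermite normal forms, reduction mod `𝓂`).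
* [Serre1979] J.-P. Serre, *Local Fields*, GTM 67 (1979), Ch. I §1 (discrete valuation rings: units and the residue field).
-/

set_option autoImplicit false

noncomputable section

namespace Summit.HodgeConjecture.HodgeConjecture.Cruxes.H413.F0P3cDyRamCoreHangingEmptyOfCardTwo

open Matrix WithZero
open Literature.NumberTheory.Automorphic Literature.NumberTheory.Automorphic.HermitianLattice
open Literature.NumberTheory.Automorphic.UnitaryLatticeTree Literature.NumberTheory.Automorphic.UnitaryThreeFourFrame
open Summit.HodgeConjecture.HodgeConjecture.Cruxes.H413.F0P3cDyRamFourFramePieces (mstarOfRecord)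
open Summit.HodgeConjecture.HodgeConjecture.Cruxes.H413.F0P3cDyRamFourFrameCensusDefs (LatticeInLevel)
open Summit.HodgeConjecture.HodgeConjecture.Cruxes.H413.F0P3cDyRamDiagonalTorusDefs
open Summit.HodgeConjecture.HodgeConjecture.Cruxes.H413.F0P3cDyRamDiagonalStrataDefs
open Summit.HodgeConjecture.HodgeConjecture.Cruxes.H413.F0P3cDyRamDiagonalKappaCountDefs (kappaCount)
open Summit.HodgeConjecture.HodgeConjecture.Cruxes.H413.F0P3cDyRamStageOneBDefs (mcOfRecord)
open Summit.HodgeConjecture.HodgeConjecture.Cruxes.H413.F0P3cDyRamLabelledOddCountDefs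
open Summit.HodgeConjecture.HodgeConjecture.Cruxes.H413.F0P3cDyRamDiagonalCoreHangingSocket (stratum_H_eq)
open Literature.Algebra.GroupRings (eq_zero_or_eq_one_of_card_eq_two two_eq_zero_of_card_eq_two)
open scoped Valued WithZero Matrix MatrixGroups

/-! ## §1  Units of `𝒪` with a two-element residue field (★ `Literature.Algebra.GroupRings.eq_zero_or_eq_one_of_card_eq_two` ∕ `two_eq_zero_of_card_eq_two`: a two-element
ring is `{0, 1}` with `2 = 0`) -/

variable {K : Type} [Field K] [Valued K ℤᵐ⁰]

/-- **THE `q = 2` DIGIT**: if the residue field `𝓀[K]` has two elements, a unit of `𝒪[K]` (an element of valuation `1`) reduces to `1`. [cite: Serre1979, Ch. I §1] -/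
theorem residue_eq_one_of_v_eq_one_of_card_two [Fintype 𝓀[K]] (hq : Fintype.card 𝓀[K] = 2) {a : K} (ha : Valued.v a = 1) :
    IsLocalRing.residue 𝒪[K] ⟨a, (Valuation.mem_integer_iff _ _).2 ha.le⟩ = 1 := by
  have hq' : Nat.card 𝓀[K] = 2 := by rw [Nat.card_eq_fintype_card, hq]
  rcases eq_zero_or_eq_one_of_card_eq_two hq' (IsLocalRing.residue 𝒪[K] ⟨a, (Valuation.mem_integer_iff _ _).2 ha.le⟩) with h | h
  · exact absurd ((residue_eq_zero_iff_v_lt_one _).1 h) (by rw [ha]; exact lt_irrefl 1)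
  · exact h

/-- **SUM OF TWO UNITS AT `q = 2`**: if `𝓀[K]` has two elements and `|a| = |b| = 1`, then `|a + b| < 1` (`a + b ≡ 1 + 1 = 2 = 0 (mod 𝓂)`). [cite: Serre1979, Ch. I §1] -/
theorem v_add_lt_one_of_v_eq_one_of_card_two [Fintype 𝓀[K]] (hq : Fintype.card 𝓀[K] = 2) {a b : K} (ha : Valued.v a = 1) (hb : Valued.v b = 1) :
    Valued.v (a + b) < 1 := by
  have hq' : Nat.card 𝓀[K] = 2 := by rw [Nat.card_eq_fintype_card, hq]
  have hA := residue_eq_one_of_v_eq_one_of_card_two hq ha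
  have hB := residue_eq_one_of_v_eq_one_of_card_two hq hb
  have hAB : IsLocalRing.residue 𝒪[K]
      ((⟨a, (Valuation.mem_integer_iff _ _).2 ha.le⟩ : 𝒪[K]) + ⟨b, (Valuation.mem_integer_iff _ _).2 hb.le⟩) = 0 := by
    rw [map_add, hA, hB, one_add_one_eq_two, two_eq_zero_of_card_eq_two hq']
  exact (residue_eq_zero_iff_v_lt_one _).1 hAB

/-- **NO EQUILATERAL KEY AT `q = 2`**: if `𝓀[K]` has two elements, `|ϖ| ≠ 0`, `|α − 1| = |β − 1| = |ϖ|ⁿ` then `|α − β| < |ϖ|ⁿ`; so an element datum with `n₁ = n₂` has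
`n₃ > n₁` — the equilateral glue window `n₁ = n₂ = n₃` of the core-hanging sockets is void at `q = 2`. [cite: Serre1979, Ch. I §1] [cite: Kottwitz1986BaseChangeUnits, §1 pp. 240–241] -/
theorem v_sub_lt_of_v_sub_one_eq_of_card_two [Fintype 𝓀[K]] (hq : Fintype.card 𝓀[K] = 2) {ϖ α β : K} (hϖ0 : ϖ ≠ 0) {n : ℕ}
    (hα : Valued.v (α - 1) = Valued.v ϖ ^ n) (hβ : Valued.v (β - 1) = Valued.v ϖ ^ n) : Valued.v (α - β) < Valued.v ϖ ^ n := by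
  have hpn : Valued.v (ϖ ^ n) ≠ 0 := by rw [map_pow]; exact pow_ne_zero _ ((Valuation.ne_zero_iff _).2 hϖ0)
  have hpn' : (ϖ ^ n : K) ≠ 0 := pow_ne_zero _ hϖ0
  have ha : Valued.v ((α - 1) * (ϖ ^ n)⁻¹) = 1 := by rw [map_mul, map_inv₀, hα, ← map_pow, mul_inv_cancel₀ hpn]
  have hb : Valued.v (-((β - 1) * (ϖ ^ n)⁻¹)) = 1 := by rw [Valuation.map_neg, map_mul, map_inv₀, hβ, ← map_pow, mul_inv_cancel₀ hpn]
  have hlt := v_add_lt_one_of_v_eq_one_of_card_two hq ha hb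
  have e : (α - 1) * (ϖ ^ n)⁻¹ + -((β - 1) * (ϖ ^ n)⁻¹) = (α - β) * (ϖ ^ n)⁻¹ := by ring
  rw [e, map_mul, map_inv₀, map_pow] at hlt
  have hpos : 0 < Valued.v ϖ ^ n := pow_pos ((Valuation.pos_iff _).2 hϖ0) _
  calc Valued.v (α - β) = Valued.v (α - β) * (Valued.v ϖ ^ n)⁻¹ * Valued.v ϖ ^ n := by
          rw [mul_assoc, inv_mul_cancel₀ hpos.ne', mul_one]
    _ < 1 * Valued.v ϖ ^ n := mul_lt_mul_of_pos_right hlt hpos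
    _ = Valued.v ϖ ^ n := one_mul _

/-- **NO EQUILATERAL ELEMENT DATUM AT `q = 2`** (datum form of the previous lemma): `IsElementDatum σ ϖ N₀ α β n₁ n₂ n₃` with `|ϖ| = exp(−1)` forces `¬ (n₁ = n₂ ∧ n₂ = n₃)`.
[cite: Kottwitz1986BaseChangeUnits, §1 pp. 240–241] [cite: Serre1979, Ch. I §1] -/
theorem not_equilateral_of_isElementDatum_of_card_two [Fintype 𝓀[K]] (hq : Fintype.card 𝓀[K] = 2) {σ : K →+* K} {ϖ : K}
    (hϖ : Valued.v ϖ = WithZero.exp (-1 : ℤ)) {N₀ : ℕ} {α β : K} {n₁ n₂ n₃ : ℕ} (hE : IsElementDatum σ ϖ N₀ α β n₁ n₂ n₃) :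
    ¬ (n₁ = n₂ ∧ n₂ = n₃) := by
  rintro ⟨h12, h23⟩
  obtain ⟨-, -, -, -, -, h₁, h₂, h₃, -, -, -⟩ := hE
  have hϖ0 : ϖ ≠ 0 := (Valuation.ne_zero_iff Valued.v).1 (by rw [hϖ]; exact WithZero.exp_ne_zero)
  subst h12; subst h23
  have hlt := v_sub_lt_of_v_sub_one_eq_of_card_two hq hϖ0 h₂ h₁
  rw [h₃] at hlt
  exact lt_irrefl _ hlt

/-! ## §2  The core-hanging stratum is empty at `q = 2` -/

/-- **THE CORE-HANGING STRATUM `(2ρ, 2ρ, 2ρ)` IS EMPTY AT `q = 2`** (`ρ ≥ 1`, any `T`; letters of ★ `stratum_H_eq`): a member would be `latt (1 0 0; x ϖ^ρ 0; xζ+y″ ϖ^ρζ ϖ^{2ρ})`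
with `|x| = |ζ| = |y″| = |xζ + y″| = 1`, but `xζ` and `y″` are units, so `|xζ + y″| < 1` when `𝓀` has two elements. [cite: Kottwitz1986BaseChangeUnits, §1 pp. 240–241]
[cite: Serre1980Trees, Ch. II §1.1] -/
theorem stratum_H_eq_empty_of_card_two [Fintype 𝓀[K]] (hq : Fintype.card 𝓀[K] = 2) {σ : K →+* K} (hvσ : ∀ a, Valued.v (σ a) = Valued.v a)
    (hfix : ∀ x : K, σ x = x → x ≠ 0 → ∃ n : ℤ, Valued.v x = WithZero.exp (2 * n)) {ϖ : K} (hϖ : Valued.v ϖ = WithZero.exp (-1 : ℤ))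
    (T : GL (Fin 3) K) {ρ : ℕ} (hρ : 1 ≤ ρ) :
    stratum σ ϖ T ![2 * ρ, 2 * ρ, 2 * ρ] = ∅ := by
  rw [stratum_H_eq hvσ hfix hϖ T hρ]
  ext M
  simp only [Set.mem_setOf_eq, Set.mem_empty_iff_false, iff_false]
  rintro ⟨-, -, x, ζ, y'', hx, hζ, hy'', hsum, -⟩
  have hxζ : Valued.v (x * ζ) = 1 := by rw [map_mul, hx, hζ, mul_one]
  exact absurd hsum (v_add_lt_one_of_v_eq_one_of_card_two hq hxζ hy'').ne

/-- **DATUM FORM**: at a ramified quadratic datum `(σ, ϖ, d, t)` over a field with two-element residue field, `stratum σ ϖ T (2ρ, 2ρ, 2ρ) = ∅` for every `T` and `ρ ≥ 1`.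
[cite: Kottwitz1986BaseChangeUnits, §1 pp. 240–241] [cite: Serre1980Trees, Ch. II §1.1] -/
theorem stratum_H_eq_empty_of_isRamifiedQuadraticDatum_of_card_two [Fintype 𝓀[K]] (hq : Fintype.card 𝓀[K] = 2) {σ : K →+* K} {ϖ : K} {d t : ℕ}
    (hD : IsRamifiedQuadraticDatum σ ϖ d t) (T : GL (Fin 3) K) {ρ : ℕ} (hρ : 1 ≤ ρ) :
    stratum σ ϖ T ![2 * ρ, 2 * ρ, 2 * ρ] = ∅ := by
  obtain ⟨-, hvσ, hϖ, hfix, -, -, -⟩ := hD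
  exact stratum_H_eq_empty_of_card_two hq hvσ hfix hϖ T hρ

/-! ## §3  Consequences for the per-stratum tables: row (P5) «H» vanishes at `q = 2` in every currency -/

/-- **EVERY TABLE ON THE H STRATUM VANISHES AT `q = 2`**: for any shell predicate `Q` and any weight `f` with values in an additive commutative monoid,
`Σᶠ_{M ∈ stratum(2ρ,2ρ,2ρ) ∧ Q M} f M = 0` (`ρ ≥ 1`, any `T`). [cite: Kottwitz1986BaseChangeUnits, §1 pp. 240–241] -/
theorem finsum_stratum_H_sep_eq_zero_of_card_two [Fintype 𝓀[K]] (hq : Fintype.card 𝓀[K] = 2) {σ : K →+* K} {ϖ : K} {d t : ℕ}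
    (hD : IsRamifiedQuadraticDatum σ ϖ d t) (T : GL (Fin 3) K) {ρ : ℕ} (hρ : 1 ≤ ρ) (Q : Submodule 𝒪[K] (Fin 3 → K) → Prop)
    {R : Type*} [AddCommMonoid R] (f : Submodule 𝒪[K] (Fin 3 → K) → R) :
    ∑ᶠ M ∈ {M : Submodule 𝒪[K] (Fin 3 → K) | M ∈ stratum σ ϖ T ![2 * ρ, 2 * ρ, 2 * ρ] ∧ Q M}, f M = 0 := by
  have hset : {M : Submodule 𝒪[K] (Fin 3 → K) | M ∈ stratum σ ϖ T ![2 * ρ, 2 * ρ, 2 * ρ] ∧ Q M} = ∅ := by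
    rw [stratum_H_eq_empty_of_isRamifiedQuadraticDatum_of_card_two hq hD T hρ]
    ext M
    simp
  rw [hset, finsum_mem_empty]

/-- **THE UNCUT H STRATUM SUM VANISHES AT `q = 2`** (no shell predicate): `Σᶠ_{M ∈ stratum(2ρ,2ρ,2ρ)} f M = 0`. [cite: Kottwitz1986BaseChangeUnits, §1 pp. 240–241] -/
theorem finsum_stratum_H_eq_zero_of_card_two [Fintype 𝓀[K]] (hq : Fintype.card 𝓀[K] = 2) {σ : K →+* K} {ϖ : K} {d t : ℕ}
    (hD : IsRamifiedQuadraticDatum σ ϖ d t) (T : GL (Fin 3) K) {ρ : ℕ} (hρ : 1 ≤ ρ)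
    {R : Type*} [AddCommMonoid R] (f : Submodule 𝒪[K] (Fin 3 → K) → R) :
    ∑ᶠ M ∈ stratum σ ϖ T ![2 * ρ, 2 * ρ, 2 * ρ], f M = 0 := by
  rw [stratum_H_eq_empty_of_isRamifiedQuadraticDatum_of_card_two hq hD T hρ, finsum_mem_empty]

/-- **ROW (P5) «H» OF THE (β) LABELLED-ODD TABLE AT `q = 2`** — the (T1) v0 binder `hH : ∀ ρ ≥ 1, v ![2ρ, 2ρ, 2ρ] = 0` of `OddLabelledBoxSum` DISCHARGED in the lattice currency of
★ p860646 `F0P3cDyRamLabelledOddStageBBoxForm.table_of_box` (clean shell `(d%2, ¬(d%2+1), mcOfRecord d)` on the letters `diag(α−1, β−1, 0)` ∕ their squares, label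
`valueClassLabel σ ϖ (α−1) (β−1) (mstarOfRecord d) d`, weight `labelledOddCount…∕[𝒰 : N S̃′]`), for every `T`, every `α β`, every slot `i` and every `ρ ≥ 1` — no element datum, no
regime, no label read needed: the stratum is empty. [cite: Kottwitz1986BaseChangeUnits, §1 pp. 240–241] [cite: Serre1980Trees, Ch. II §1.1] -/
theorem finsum_stratum_H_shell_labelledOdd_div_relIndex_eq_zero_of_card_two [Fintype 𝓀[K]] (hq : Fintype.card 𝓀[K] = 2) {σ : K →+* K} {ϖ : K} {d t : ℕ}
    (hD : IsRamifiedQuadraticDatum σ ϖ d t) (T : GL (Fin 3) K) (α β : K) (i : Fin 3) (ρ : ℕ) (hρ : 1 ≤ ρ) :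
    ∑ᶠ M₀ ∈ {M : Submodule 𝒪[K] (Fin 3 → K) | M ∈ stratum σ ϖ T ![2 * ρ, 2 * ρ, 2 * ρ] ∧
        (LatticeInLevel ϖ (d % 2) (Matrix.diagonal ![α - 1, β - 1, 0]) M ∧ ¬ LatticeInLevel ϖ (d % 2 + 1) (Matrix.diagonal ![α - 1, β - 1, 0]) M ∧
          LatticeInLevel ϖ (mcOfRecord d) (Matrix.diagonal ![(α - 1) * (α - 1), (β - 1) * (β - 1), 0]) M)},
      (labelledOddCount σ ϖ 0 i (valueClassLabel σ ϖ (α - 1) (β - 1) (mstarOfRecord d) d) M₀ : ℚ) /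
        ((((unitStabilizer M₀).map (unitNormMap σ 3)).relIndex (fixedUnitTorus σ 3) : ℕ) : ℚ) = 0 :=
  finsum_stratum_H_sep_eq_zero_of_card_two hq hD T hρ _ _

/-- **ROW «H» OF THE `κ·w` TABLES AT `q = 2`** (the (L-lev)∕(sq) roads' currency, ★ `cell_H`): for any two level predicates `L₁ L₂` and every slot `i`,
`Σᶠ_{M ∈ stratum(2ρ,2ρ,2ρ) ∧ (L₁ M ∧ L₂ M)} κ₀,ᵢ(M)·w(M) = 0`. [cite: Kottwitz1986BaseChangeUnits, §1 pp. 240–241] -/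
theorem finsum_stratum_H_sep_kappaCount_mul_stabiliserWeight_eq_zero_of_card_two [Fintype 𝓀[K]] (hq : Fintype.card 𝓀[K] = 2) {σ : K →+* K} {ϖ : K} {d t : ℕ}
    (hD : IsRamifiedQuadraticDatum σ ϖ d t) (T : GL (Fin 3) K) (i : Fin 3) (ρ : ℕ) (hρ : 1 ≤ ρ) (L₁ L₂ : Submodule 𝒪[K] (Fin 3 → K) → Prop) :
    ∑ᶠ M ∈ {M : Submodule 𝒪[K] (Fin 3 → K) | M ∈ stratum σ ϖ T ![2 * ρ, 2 * ρ, 2 * ρ] ∧ (L₁ M ∧ L₂ M)},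
      (kappaCount σ ϖ 0 i M : ℚ) * stabiliserWeight σ M = 0 :=
  finsum_stratum_H_sep_eq_zero_of_card_two hq hD T hρ _ _

end Summit.HodgeConjecture.HodgeConjecture.Cruxes.H413.F0P3cDyRamCoreHangingEmptyOfCardTwo

end
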